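import Summits.Ventures.PercRepro.SignVec

/-!
# PercRepro — the dimension of a colour class is the rank of its Gram matrix `8I + 4A` (typer-2, gen 5)

p4 (10:27:18Z): to state piece (H) of the CodeBound8 proof as a MATRIX-RANK fact, the dimension of the span
`U_X` of the sign vectors of a colour class `X` must be the rank of the sign-vector matrix, and that rank the rank
of the Gram matrix `X Xᵀ = 8I + 4A` (`A` = the «meet in 3» adjacency of the class). This file is that glue:

* `signMat X : Matrix X (Fin 8) ℝ` — rows = the sign vectors of the members of `X`;
* **`finrank_span_signVec_eq_rank`** — `finrank U_X = (signMat X).rank` (`Matrix.rank_eq_finrank_span_row`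
  transported along `WithLp.linearEquiv`);
* **`signMat_mul_transpose`** — `(signMat X * (signMat X)ᵀ) σ τ = 4·|σ ∩ τ| − 2·|σ| − 2·|τ| + 8`
  (the Gram entries, `inner_signVec`); **`rank_signMat_eq_rank_gram`** — `(signMat X).rank = (X Xᵀ).rank`
  (`Matrix.rank_self_mul_transpose`);
* `meet3Adj X` — the adjacency matrix of «distinct members meeting in 3 points»;
  **`gram_eq_of_code`** — for a class of 4-sets in which distinct members meet in `2` or `3` points (p4 §9.1 (ii):
  the oriented representatives of one bipartition type — `|σ ∩ τ| ≥ 2` since `σ` and `τ̄` have different colours),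
  `signMat X * (signMat X)ᵀ = 8 • 1 + 4 • meet3Adj X`; hence **`finrank_span_signVec_eq_rank_gram`**:
  `finrank U_X = (8 • 1 + 4 • meet3Adj X).rank`; `rank_smul_eq`, `rank_gram_eq_rank_two_add` and
  **`finrank_span_signVec_eq_rank_two_add`**: `finrank U_X = (2 • 1 + meet3Adj X).rank`. Piece (H) is now the
  statement `(2 • 1 + meet3Adj X).rank ≥ h(|X|)`, a fact about a `0/1` symmetric matrix (p4);
  `le_rank_of_det_submatrix_ne_zero` turns a nonzero principal minor into a rank lower bound (piece (G)).
-/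

namespace PercRepro

open Module Submodule Finset Matrix

/-- The sign matrix of a family `X` of subsets of `[8]`: rows = the members of `X`, columns = `Fin 8`. -/
noncomputable def signMat (X : Finset (Finset (Fin 8))) : Matrix X (Fin 8) ℝ :=
  fun σ i => signVec σ.1 i

/-- The rows of the sign matrix are the sign vectors of `X`, read as plain functions. -/
theorem range_signMat_row (X : Finset (Finset (Fin 8))) :
    Set.range (signMat X).row =
      (WithLp.linearEquiv 2 ℝ (Fin 8 → ℝ) : EuclideanSpace ℝ (Fin 8) →ₗ[ℝ] (Fin 8 → ℝ)) ''
        (signVec '' (X : Set (Finset (Fin 8)))) := by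
  ext v
  constructor
  · rintro ⟨σ, rfl⟩
    exact ⟨signVec σ.1, ⟨σ.1, σ.2, rfl⟩, rfl⟩
  · rintro ⟨_, ⟨σ, hσ, rfl⟩, rfl⟩
    exact ⟨⟨σ, hσ⟩, rfl⟩

/-- **The dimension of the span of a class's sign vectors is the rank of its sign matrix.** -/
theorem finrank_span_signVec_eq_rank (X : Finset (Finset (Fin 8))) :
    finrank ℝ (span ℝ (signVec '' (X : Set (Finset (Fin 8))))) = (signMat X).rank := by
  rw [Matrix.rank_eq_finrank_span_row, range_signMat_row, ← Submodule.map_span,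
    LinearEquiv.finrank_map_eq]

/-- The Gram matrix of the sign vectors: entries `4·|σ ∩ τ| − 2·|σ| − 2·|τ| + 8`. -/
theorem signMat_mul_transpose (X : Finset (Finset (Fin 8))) (σ τ : X) :
    (signMat X * (signMat X)ᵀ) σ τ =
      4 * (σ.1 ∩ τ.1).card - 2 * σ.1.card - 2 * τ.1.card + 8 := by
  rw [← inner_signVec, PiLp.inner_apply, Matrix.mul_apply]
  refine Finset.sum_congr rfl fun i _ => ?_
  simp only [signMat, Matrix.transpose_apply, RCLike.inner_apply, conj_trivial]
  ring

/-- The rank of the sign matrix is the rank of its Gram matrix. -/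
theorem rank_signMat_eq_rank_gram (X : Finset (Finset (Fin 8))) :
    (signMat X).rank = (signMat X * (signMat X)ᵀ).rank :=
  (Matrix.rank_self_mul_transpose _).symm

/-- The «meet in 3» adjacency matrix of a class of sets: `1` on distinct members meeting in three points. -/
noncomputable def meet3Adj (X : Finset (Finset (Fin 8))) : Matrix X X ℝ :=
  fun σ τ => if σ ≠ τ ∧ (σ.1 ∩ τ.1).card = 3 then 1 else 0

/-- **The Gram matrix of a code class is `8I + 4A`**: for a class of 4-sets whose distinct members meet in
`2` or `3` points, `signMat X * (signMat X)ᵀ = 8 • 1 + 4 • meet3Adj X`. -/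
theorem gram_eq_of_code (X : Finset (Finset (Fin 8))) (hX : ∀ σ ∈ X, σ.card = 4)
    (hmeet : ∀ σ ∈ X, ∀ τ ∈ X, σ ≠ τ → (σ ∩ τ).card = 2 ∨ (σ ∩ τ).card = 3) :
    signMat X * (signMat X)ᵀ = (8 : ℝ) • (1 : Matrix X X ℝ) + (4 : ℝ) • meet3Adj X := by
  ext σ τ
  rw [signMat_mul_transpose, hX σ.1 σ.2, hX τ.1 τ.2]
  simp only [Matrix.add_apply, Matrix.smul_apply, Matrix.one_apply, meet3Adj, smul_eq_mul]
  by_cases hst : σ = τ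
  · subst hst
    rw [Finset.inter_self, hX σ.1 σ.2, if_pos rfl, if_neg (fun h => h.1 rfl)]
    norm_num
  · have hne : σ.1 ≠ τ.1 := fun h => hst (Subtype.ext h)
    rcases hmeet σ.1 σ.2 τ.1 τ.2 hne with h2 | h3
    · rw [h2, if_neg hst, if_neg (fun h => absurd h.2 (by norm_num))]
      norm_num
    · rw [h3, if_neg hst, if_pos ⟨hst, rfl⟩]
      norm_num

/-- **The dimension of a code class is the rank of `8I + 4A`.** -/
theorem finrank_span_signVec_eq_rank_gram (X : Finset (Finset (Fin 8))) (hX : ∀ σ ∈ X, σ.card = 4)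
    (hmeet : ∀ σ ∈ X, ∀ τ ∈ X, σ ≠ τ → (σ ∩ τ).card = 2 ∨ (σ ∩ τ).card = 3) :
    finrank ℝ (span ℝ (signVec '' (X : Set (Finset (Fin 8))))) =
      ((8 : ℝ) • (1 : Matrix X X ℝ) + (4 : ℝ) • meet3Adj X).rank := by
  rw [finrank_span_signVec_eq_rank, rank_signMat_eq_rank_gram, gram_eq_of_code X hX hmeet]

/-- A nonzero scalar does not change the rank of a square matrix (the scalar is the invertible diagonal
matrix `diagonal (fun _ => c)` on the left). -/
theorem rank_smul_eq {m : Type*} [Fintype m] [DecidableEq m] (c : ℝ) (hc : c ≠ 0) (M : Matrix m m ℝ) :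
    (c • M).rank = M.rank := by
  rw [Matrix.smul_eq_diagonal_mul]
  refine Matrix.rank_mul_eq_right_of_isUnit_det _ _ ?_
  rw [Matrix.det_diagonal, Finset.prod_const]
  exact IsUnit.pow _ (Ne.isUnit hc)

/-- **`rank(8I + 4A) = rank(2I + A)`**: the Gram matrix is `4·(2I + A)`. -/
theorem rank_gram_eq_rank_two_add (X : Finset (Finset (Fin 8))) :
    ((8 : ℝ) • (1 : Matrix X X ℝ) + (4 : ℝ) • meet3Adj X).rank =
      ((2 : ℝ) • (1 : Matrix X X ℝ) + meet3Adj X).rank := by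
  have h : (8 : ℝ) • (1 : Matrix X X ℝ) + (4 : ℝ) • meet3Adj X =
      (4 : ℝ) • ((2 : ℝ) • (1 : Matrix X X ℝ) + meet3Adj X) := by
    rw [smul_add, smul_smul]
    norm_num
  rw [h, rank_smul_eq (4 : ℝ) (by norm_num)]

/-- **The dimension of a code class is `rank(2I + A)`** — p4's piece (H) in its final Lean shape. -/
theorem finrank_span_signVec_eq_rank_two_add (X : Finset (Finset (Fin 8))) (hX : ∀ σ ∈ X, σ.card = 4)
    (hmeet : ∀ σ ∈ X, ∀ τ ∈ X, σ ≠ τ → (σ ∩ τ).card = 2 ∨ (σ ∩ τ).card = 3) :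
    finrank ℝ (span ℝ (signVec '' (X : Set (Finset (Fin 8))))) =
      ((2 : ℝ) • (1 : Matrix X X ℝ) + meet3Adj X).rank := by
  rw [finrank_span_signVec_eq_rank_gram X hX hmeet, rank_gram_eq_rank_two_add]

/-- **A nonzero principal minor bounds the rank from below**: if `det (A.submatrix r r) ≠ 0` for some
`r : Fin k → m`, then `k ≤ A.rank` (the glue p4's piece (G) needs: a nonzero `4 × 4` principal minor of
`2I + A` gives `rank(2I + A) ≥ 4`). -/
theorem le_rank_of_det_submatrix_ne_zero {m : Type*} [Fintype m] [DecidableEq m] (A : Matrix m m ℝ)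
    {k : ℕ} (r : Fin k → m) (h : (A.submatrix r r).det ≠ 0) : k ≤ A.rank := by
  have hu : IsUnit (A.submatrix r r) := (Matrix.isUnit_iff_isUnit_det _).mpr (Ne.isUnit h)
  have h1 : (A.submatrix r r).rank = k := by
    rw [Matrix.rank_of_isUnit _ hu, Fintype.card_fin]
  rw [← h1]
  exact Matrix.rank_submatrix_le A r r

end PercRepro
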